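import Summits.QuantumFields.BalabanUV.T4Continuum.Support.NE7ClassFluxGradBound
import Summits.QuantumFields.BalabanUV.T4Continuum.Support.NE7AllMinimisersSmallSU2
import Summits.QuantumFields.BalabanUV.T4Continuum.Support.NE7OpenOfMinimisation
import Summits.QuantumFields.BalabanUV.T4Continuum.Support.GaugeFieldPerturbation
import HarnessLib

/-!
# NE7AllMinimisersFluxGradSU2 — supplier stub (S-h) of the NE7 crux, part (c7) (ROAD-G108 §4): (10) TYPE UP TO A LOGARITHM FOR EVERY CONSTRAINED MINIMISER OVER THE SMALL DATA
# (SU(2), d = 4, L = 2) — `card n = 2 → ∃ ε₀ > 0, ∀ 0 < ε ≤ ε₀, ∃ c ≥ 0, ∀ N ≥ 1, ∃ δ_V > 0`: for every datum `V` of the small data of radius `δ_V`, every level `k` and EVERY minimiser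
# `U` of the `ε`-class at level `k` over `V`: `‖∇_U F(x; κ, π)‖ ≤ c·(1+k)∕(2^k)³` at every bond and plane — EXACTLY the log-tolerant regularity hypothesis `hreg10` of
# `NE7Route1EndDockedSmallDataSU2Log`, now a THEOREM

Cell `pub-balaban`, rung (B)+1 sub-cell t4, lineage `b2b-balaban-t4-ne7-p1`, generation 108 (CRUX PROVER NE7 #1 = OWNER of BINDER row NE7).  Memo `t4/b2b-balaban-t4-ne7-p1-g108/ROAD-G108.md` §4 (c).
THE ARGUMENT.  Level `0`: `‖∇_U F‖ ≤ 2·sup‖F‖ ≤ 4ε` (`GaugeFieldPerturbation.norm_flux_le_of_smallField`, class radius `ε`).  Level `k+1`: every minimiser over the small data is interior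
(gen 105's (8)∀ `NE7AllMinimisersSmallSU2.all_minimisers_small_SU2`: `SmallField U ((ε∕4)∕M²)`), hence TANGENT-CRITICAL (gen 90's Fermat theorem `NE7OpenOfMinimisation.tanCritical_of_isMinimiser`),
hence THIS generation's class letter `NE7ClassFluxGradBound.exists_classFluxGradConst` applies: `‖∇_U F‖ ≤ C·ε·(2+k)∕M³`.  Constant `c = (C + 4)·ε`.
WHAT ([folklore]; 0 def, 0 sorry).  **`all_minimisers_fluxGrad_SU2`** (displayed above).
HONEST FRAMING (page 1): composition of landed kernel theorems ((8)∀ gen 105, Fermat gen 90, (c1)–(c6) gen 108, NE7b's flat interior letter gen 155, the pointwise tension gen 91); this is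
[Balaban1985Variational] Thm 1 (10)'s SHAPE WITH A LOGARITHM (`(1+k)`), proved here for OUR constrained minimisers by OUR route (Hodge system of the curvature + interior estimate), NOT Bałaban's
(10) and NOT by his method; nothing of Bałaban's asserted as an axiom; SU(2), `L = 2`, finite 4-torus; NOT NE3∕NE7 as spine nodes (the END keeps `hsector`, the data-class binders and rows
U2∕U3∕(D)); spine count = dagwriter∕referees' call; NOT infinite volume, NOT mass gap, NOT BetaPertH, NOT Clay.
-/

set_option autoImplicit false

open scoped BigOperators Matrix Matrix.Norms.L2Operator
open NormedSpace Finset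

namespace Summit.QuantumFields.BalabanUV.T4Continuum.NE7AllMinimisersFluxGradSU2

open Literature.MathematicalPhysics.QuantumFieldTheory.Balaban1983to89
open B7Prop1Explicit B7Prop2Explicit
open T4AveragingDeficitWall (IsUnitaryCfg IsSkewDir SmallField Ad covGrad flux)
open T4AveragingDeficitWallBoundary (IsPeriodicCfg periodBox)
open AveragingDeficitPeriodicCounting (IsPeriodicDir)
open AveragingDeficitTransport (norm_Ad_of_unitary)
open AveragingDeficitMultiLevelPrep (LevelSmall TangentIter)
open MinimalActionSandwich (IsMinimiser admissible)
open MinimalActionRate (sfClass)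
open GaugeFieldPerturbation (norm_flux_le_of_smallField)
open NE7ConvOneStepSU2 (levelSmall_all_d4_L2)
open NE7AllMinimisersSmallSU2 (all_minimisers_small_SU2)
open NE7OpenOfMinimisation (tanCritical_of_isMinimiser)
open NE7ClassFluxGradBound (exists_classFluxGradConst)

noncomputable section

variable {n : Type} [Fintype n] [DecidableEq n]

set_option maxHeartbeats 400000 in
/-- **(10) TYPE UP TO A LOGARITHM FOR EVERY CONSTRAINED MINIMISER OVER THE SMALL DATA (SU(2), `d = 4`, `L = 2`)** (statement in the file header). [folklore] -/
theorem all_minimisers_fluxGrad_SU2 [Nonempty n] (hn : Fintype.card n = 2) :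
    ∃ ε₀ : ℝ, 0 < ε₀ ∧ ∀ ε : ℝ, 0 < ε → ε ≤ ε₀ → ∃ c : ℝ, 0 ≤ c ∧ ∀ (N : ℕ) [NeZero N], 1 ≤ N →
      ∃ δV : ℝ, 0 < δV ∧
        ∀ V ∈ {V : Site 4 → Fin 4 → (Matrix n n ℂ)ˣ | IsUnitaryCfg V ∧ IsPeriodicCfg V (N : ℤ) ∧ SmallField V δV},
        ∀ (k : ℕ) (U : Site 4 → Fin 4 → (Matrix n n ℂ)ˣ), IsMinimiser 4 (sfClass 4 2 N ε) 2 N k V U →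
          ∀ (x : Site 4) (κ : Fin 4) (π : T4AveragingDeficitWall.Plane 4),
            ‖covGrad U (flux U) x κ π‖ ≤ c * (1 + (k : ℝ)) / (((2 : ℕ) : ℝ) ^ k) ^ 3 := by
  obtain ⟨ε₁, hε₁, H1⟩ := all_minimisers_small_SU2 (n := n) hn
  obtain ⟨C, hC, H2⟩ := exists_classFluxGradConst (n := n)
  refine ⟨min ε₁ (1 / 10 ^ 53), lt_min hε₁ (by norm_num), ?_⟩
  intro ε hε hεle
  have hεε₁ : ε ≤ ε₁ := hεle.trans (min_le_left _ _)
  have hε53 : ε ≤ 1 / 10 ^ 53 := hεle.trans (min_le_right _ _)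
  refine ⟨(C + 4) * ε, by positivity, fun N _ hN => ?_⟩
  obtain ⟨δV, hδV, Hsmall⟩ := H1 ε hε hεε₁ N hN
  refine ⟨δV, hδV, ?_⟩
  rintro V hV k U hmin x κ ⟨⟨μ, ν⟩, hμν⟩
  cases k with
  | zero =>
      -- level 0: the trivial bound `‖∇_U F‖ ≤ 2·sup‖F‖ ≤ 4ε`
      have hUu : IsUnitaryCfg U := hmin.mem.1.1
      have hUx : SmallField U (ε / (((2 : ℕ) : ℝ) ^ 0) ^ 2) := hmin.mem.1.2.2
      rw [pow_zero, one_pow, div_one] at hUx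
      have hflux := norm_flux_le_of_smallField hUx (hε53.trans (by norm_num))
      have h1 : ‖covGrad U (flux U) x κ ⟨(μ, ν), hμν⟩‖ ≤ 2 * ε + 2 * ε := by
        unfold covGrad
        refine (norm_sub_le _ _).trans (add_le_add ?_ (hflux _))
        rw [norm_Ad_of_unitary (hUu x κ)]
        exact hflux _
      have e : (C + 4) * ε * (1 + ((0 : ℕ) : ℝ)) / (((2 : ℕ) : ℝ) ^ 0) ^ 3 = C * ε + 4 * ε := by push_cast; ring
      rw [e]
      nlinarith
  | succ j =>
      -- level `j+1`: interior ⟹ tangent-critical ⟹ the class letter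
      have hUa := Hsmall V hV (j + 1) U hmin
      have ha0 : 0 ≤ (ε / 4) / (((2 : ℕ) : ℝ) ^ (j + 1)) ^ 2 := by positivity
      have haε : (ε / 4) / (((2 : ℕ) : ℝ) ^ (j + 1)) ^ 2 < ε / (((2 : ℕ) : ℝ) ^ (j + 1)) ^ 2 :=
        div_lt_div_of_pos_right (by linarith) (by positivity)
      have hls : LevelSmall 4 2 j (ε / (((2 : ℕ) : ℝ) ^ (j + 1)) ^ 2) := levelSmall_all_d4_L2 hε.le (hε53.trans (by norm_num)) j
      have hcrit := tanCritical_of_isMinimiser (d := 4) (L := 2) (le_refl 1 |>.trans one_le_two) hN hmin ha0 haε hUa hls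
      have h := H2 N ε hε hε53 V j U hmin.mem hcrit x κ μ ν hμν
      refine h.trans (div_le_div_of_nonneg_right ?_ (by positivity))
      have hkk : (0 : ℝ) ≤ 1 + ((j + 1 : ℕ) : ℝ) := by positivity
      nlinarith [mul_nonneg hε.le hkk]

end

end Summit.QuantumFields.BalabanUV.T4Continuum.NE7AllMinimisersFluxGradSU2
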